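import Mathlib
import HarnessLib
import Summits.NavierStokesRegularity.NavierStokesRegularity.Theorems.PoloidalWindowDoorPoloidalWindowRigidityMovingBallMaxPrinciple

/-!
# Route `PoloidalWindowDoor`, crux `PoloidalWindowRigidity` (K2, stmt-NavierStokesRegularity-19708) — kernel tool:
# the PARABOLIC STRONG MAXIMUM PRINCIPLE for bounded-drift sub-solutions on whole-space slabs

Cell ns-regularity-ideate, seat nsreg-p7 gen 5 (third worker under the K2 lead ns-poloidal-K2-p1; file landed
`--supports stmt-NavierStokesRegularity-19708`).  The K2 programme uses maximum principles for transported–diffused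
scalars at every turn (KNSS-type M1 arguments, the Clebsch-slope law of K2P1-S2-NOTES §4 «constant by the strong maximum
principle at an interior extremum», the enstrophy Gronwall of CENSUS-K2G §16); the tree so far has only WEAK principles
(`…BoundedSubsolutionMaxPrinciple.le_of_bounded_subsolution`, `…WholeSpaceComparison.sign_mul_le_of_superBarrier`,
`Literature…ParabolicComparison.paraboloid_comparison`; cf. `Literature…AxisymNoSwirlQuotMaxPrinciple`: «NOT here: the
strong maximum principle»).  This file proves the STRONG one from the moving-ball principle and the moving quartic
barrier of the companion file `…MovingBallMaxPrinciple`: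

* `lt_of_gap_on_ball` — PROPAGATION: if a bounded-drift sub-solution `w ≤ M` on the slab has `w(t₁, ·) ≤ M − γ` on a
  closed ball `B̄(x₁, r)`, then `w(t, x₁ + (t − t₁)ξ) < M` for every later `t` and EVERY velocity `ξ` (Galilean boost of
  Nirenberg's cylinder step: comparison with `M − η` on the moving ball);
* `strongMaximumPrinciple` — **if `w ≤ M` on `[t₀, T] × ℝ³` and `w(t⋆, x⋆) = M` at some `t⋆ ∈ (t₀, T]`, then `w ≡ M` on
  `[t₀, t⋆) × ℝ³`** (Nirenberg 1953; Lieberman 1996, Ch. II Thm. 2.7; Evans §7.1.4 Thm. 11 for the heat equation);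
  `eq_of_interior_max` adds the slice `t = t⋆` by continuity;
* `dissipation_eq_zero_of_max` — bookkeeping corollary: if moreover `∂ₜw + Dw(b) − Δw ≤ −D` with `D ≥ 0`, then
  `D ≡ 0` on `(t₀, t⋆) × ℝ³` (where `w` is constant every term of the operator vanishes).

Hypothesis shapes are those of `le_of_bounded_subsolution` (joint continuity on the slab, `C²` slices, a classical time
derivative `wt`, the pointwise inequality, a drift bound `‖b‖ ≤ A`); no boundedness of `w` is needed (the argument is
local: compact moving balls), and `b` need not be continuous.

WHAT THIS IS NOT: not a claim about Navier–Stokes — a linear parabolic lemma (bears_on LADDER-NS N0, route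
PoloidalWindowDoor, crux K2; consumed by the companion file `…CriticalProduction`).
-/

noncomputable section

-- the summit and its single sub-problem share the name (CONVENTIONS §1), as in every Theorems file
set_option linter.dupNamespace false

namespace Summit.NavierStokesRegularity.NavierStokesRegularity.Theorems.PoloidalWindowDoorPoloidalWindowRigidityStrongMaxPrinciple

open MeasureTheory Set Function Filter Topology TopologicalSpace Metric InnerProductSpace
open scoped RealInnerProductSpace InnerProductSpace Laplacian ContDiff
open Literature.Analysis Literature.Analysis.FluidPDE

open Summit.NavierStokesRegularity.NavierStokesRegularity.Theorems.PoloidalWindowDoorPoloidalWindowRigidityMovingBallMaxPrinciple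

/-! ### Propagation of a gap along every ray (Nirenberg's cylinder step, boosted) -/

/-- **Strict sub-maximality propagates along every ray.**  On the slab `[t₀, T] × ℝ³`: a classical sub-solution `w` of
`∂ₜw + Dw(b) − Δw ≤ 0` with `‖b‖ ≤ A` and `w ≤ M`, which at some time `t₁ ∈ [t₀, T)` satisfies `w(t₁, ·) ≤ M − γ`
(`γ > 0`) on the closed ball `B̄(x₁, r)` (`r > 0`), satisfies `w(t, x₁ + (t − t₁)ξ) < M` for every `t ∈ (t₁, T]` and
every velocity `ξ`.  (Comparison with `M − η` on the moving ball, `η` the moving quartic bump with `δ = γ/r⁴` and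
`32 Λ r² = (4r(A + ‖ξ‖) + 20)²`.) [cite: Lieberman1996, Ch. II Thm. 2.7 (proof)] -/
theorem lt_of_gap_on_ball {b : ℝ → EuclideanSpace ℝ (Fin 3) → EuclideanSpace ℝ (Fin 3)} {A M : ℝ}
    {w wt : ℝ → EuclideanSpace ℝ (Fin 3) → ℝ} {t₀ T : ℝ}
    (hbA : ∀ t ∈ Icc t₀ T, ∀ x, ‖b t x‖ ≤ A)
    (hw_c : ContinuousOn (uncurry w) (Icc t₀ T ×ˢ univ))
    (hw2 : ∀ t ∈ Icc t₀ T, ContDiff ℝ 2 (w t))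
    (hwt : ∀ x, ∀ t ∈ Icc t₀ T, HasDerivAt (fun τ => w τ x) (wt t x) t)
    (hlaw : ∀ t ∈ Icc t₀ T, ∀ x, wt t x + fderiv ℝ (w t) x (b t x) - (Δ (w t)) x ≤ 0)
    (hle : ∀ t ∈ Icc t₀ T, ∀ x, w t x ≤ M)
    {t₁ : ℝ} (ht₁ : t₁ ∈ Ico t₀ T) {x₁ : EuclideanSpace ℝ (Fin 3)} {r γ : ℝ} (hr : 0 < r) (hγ : 0 < γ)
    (hgap : ∀ x, ‖x - x₁‖ ≤ r → w t₁ x ≤ M - γ) (ξ : EuclideanSpace ℝ (Fin 3)) :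
    ∀ t ∈ Ioc t₁ T, w t (x₁ + (t - t₁) • ξ) < M := by
  have hA0 : 0 ≤ A := (norm_nonneg _).trans (hbA t₁ ⟨ht₁.1, ht₁.2.le⟩ x₁)
  -- the constants of the barrier
  set B : ℝ := 4 * r * (A + ‖ξ‖) + 20 with hB
  set Λ : ℝ := B ^ 2 / (32 * r ^ 2) with hΛ
  have hΛeq : B ^ 2 ≤ 32 * Λ * r ^ 2 := by
    rw [hΛ]; field_simp; exact le_rfl
  set δ : ℝ := γ / r ^ 4 with hδ
  have hδ0 : 0 < δ := by rw [hδ]; positivity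
  -- the barrier and the comparison function
  set η : ℝ → EuclideanSpace ℝ (Fin 3) → ℝ := fun t x =>
    δ * Real.exp (-Λ * (t - t₁)) * (r ^ 2 - ‖x - (x₁ + (t - t₁) • ξ)‖ ^ 2) ^ 2 with hηdef
  set ηt : ℝ → EuclideanSpace ℝ (Fin 3) → ℝ := fun t x =>
    δ * Real.exp (-Λ * (t - t₁)) *
      (-Λ * (r ^ 2 - ‖x - (x₁ + (t - t₁) • ξ)‖ ^ 2) ^ 2 +
        4 * (r ^ 2 - ‖x - (x₁ + (t - t₁) • ξ)‖ ^ 2) * ⟪x - (x₁ + (t - t₁) • ξ), ξ⟫_ℝ) with hηtdef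
  set u : ℝ → EuclideanSpace ℝ (Fin 3) → ℝ := fun t x => w t x - M + η t x with hudef
  set ut : ℝ → EuclideanSpace ℝ (Fin 3) → ℝ := fun t x => wt t x + ηt t x with hutdef
  have hsub : Icc t₁ T ⊆ Icc t₀ T := Icc_subset_Icc ht₁.1 le_rfl
  -- regularity of `η`
  have hη_cont : Continuous (uncurry η) := by
    have h1 : Continuous fun p : ℝ × EuclideanSpace ℝ (Fin 3) => p.2 - (x₁ + (p.1 - t₁) • ξ) :=
      continuous_snd.sub (continuous_const.add ((continuous_fst.sub continuous_const).smul continuous_const))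
    have h2 : Continuous fun p : ℝ × EuclideanSpace ℝ (Fin 3) => Real.exp (-Λ * (p.1 - t₁)) :=
      (continuous_const.mul (continuous_fst.sub continuous_const)).rexp
    exact (continuous_const.mul h2).mul ((continuous_const.sub (h1.norm.pow 2)).pow 2)
  have hη2 : ∀ t, ContDiff ℝ 2 (η t) := fun t =>
    contDiff_bump (δ * Real.exp (-Λ * (t - t₁))) r (x₁ + (t - t₁) • ξ)
  have hηt : ∀ x t, HasDerivAt (fun τ => η τ x) (ηt t x) t := fun x t =>
    hasDerivAt_movingBump δ Λ r t₁ x x₁ ξ t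
  -- hypotheses of the moving-ball maximum principle for `u` on `[t₁, T]`
  have hu_c : ContinuousOn (uncurry u) (Icc t₁ T ×ˢ univ) := by
    have h1 : ContinuousOn (uncurry w) (Icc t₁ T ×ˢ univ) := hw_c.mono (prod_mono hsub le_rfl)
    have h2 : ContinuousOn (fun p : ℝ × EuclideanSpace ℝ (Fin 3) => uncurry w p - M + uncurry η p)
        (Icc t₁ T ×ˢ univ) := (h1.sub continuousOn_const).add hη_cont.continuousOn
    exact h2.congr fun p _ => rfl
  have hu2 : ∀ t ∈ Icc t₁ T, ContDiff ℝ 2 (u t) := fun t ht =>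
    ((hw2 t (hsub ht)).sub contDiff_const).add (hη2 t)
  have hut : ∀ x, ∀ t ∈ Icc t₁ T, HasDerivAt (fun τ => u τ x) (ut t x) t := fun x t ht =>
    ((hwt x t (hsub ht)).sub_const M).add (hηt x t)
  have hlaw_u : ∀ t ∈ Ioc t₁ T, ∀ x, ‖x - (x₁ + (t - t₁) • ξ)‖ < r →
      ut t x + fderiv ℝ (u t) x (b t x) - (Δ (u t)) x ≤ 0 := by
    intro t ht x hx
    have htI : t ∈ Icc t₀ T := hsub ⟨ht.1.le, ht.2⟩
    have hwd : DifferentiableAt ℝ (w t) x := (hw2 t htI).differentiable two_ne_zero x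
    have hηd : DifferentiableAt ℝ (η t) x := (hη2 t).differentiable two_ne_zero x
    have hD : fderiv ℝ (u t) x = fderiv ℝ (w t) x + fderiv ℝ (η t) x := by
      have h1 : u t = fun y => (w t y - M) + η t y := by funext y; simp [hudef]
      rw [h1, fderiv_fun_add (hwd.sub_const M) hηd, fderiv_sub_const]
    have hL : (Δ (u t)) x = (Δ (w t)) x + (Δ (η t)) x := by
      have h1 : u t = (fun y => w t y - M) + η t := by funext y; simp [hudef]
      have h2 : (fun y => w t y - M) = (w t) - fun _ => M := by funext y; simp
      rw [h1, ((hw2 t htI).sub contDiff_const).contDiffAt.laplacian_add (hη2 t).contDiffAt, h2,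
        (hw2 t htI).contDiffAt.laplacian_sub contDiffAt_const, laplacian_const]
      simp
    have hηlaw : ηt t x + fderiv ℝ (η t) x (b t x) - (Δ (η t)) x ≤ 0 :=
      movingBump_law hδ0.le hr (hbA t htI x) hΛeq hx.le
    have hwlaw := hlaw t htI x
    simp only [hutdef, hD, hL, add_apply]
    linarith
  have hbot : ∀ x, ‖x - x₁‖ ≤ r → u t₁ x ≤ 0 := by
    intro x hx
    have h1 : η t₁ x = δ * (r ^ 2 - ‖x - x₁‖ ^ 2) ^ 2 := by simp [hηdef]
    have h2 : (r ^ 2 - ‖x - x₁‖ ^ 2) ^ 2 ≤ (r ^ 2) ^ 2 := by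
      have h3 : 0 ≤ r ^ 2 - ‖x - x₁‖ ^ 2 := sub_nonneg.2 (pow_le_pow_left₀ (norm_nonneg _) hx 2)
      have h4 : r ^ 2 - ‖x - x₁‖ ^ 2 ≤ r ^ 2 := sub_le_self _ (sq_nonneg _)
      exact pow_le_pow_left₀ h3 h4 2
    have h5 : δ * (r ^ 2) ^ 2 = γ := by rw [hδ]; field_simp
    have h6 : η t₁ x ≤ γ := by
      rw [h1, ← h5]; exact mul_le_mul_of_nonneg_left h2 hδ0.le
    have h7 := hgap x hx
    simp only [hudef]
    linarith
  have hside : ∀ t ∈ Icc t₁ T, ∀ x, ‖x - (x₁ + (t - t₁) • ξ)‖ = r → u t x ≤ 0 := by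
    intro t ht x hx
    have h1 : η t x = 0 := by simp [hηdef, hx]
    have h2 := hle t (hsub ht) x
    simp only [hudef, h1, add_zero, sub_nonpos]
    exact h2
  have hmp := movingBall_maxPrinciple (b := b) ht₁.2.le x₁ ξ hu_c hu2 hut hlaw_u hbot hside
  -- evaluate at the moving centre
  intro t ht
  have htI : t ∈ Icc t₁ T := ⟨ht.1.le, ht.2⟩
  have h1 := hmp t htI (x₁ + (t - t₁) • ξ) (by simp [hr.le])
  have h2 : η t (x₁ + (t - t₁) • ξ) = δ * Real.exp (-Λ * (t - t₁)) * (r ^ 2) ^ 2 := by simp [hηdef]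
  have h3 : 0 < δ * Real.exp (-Λ * (t - t₁)) * (r ^ 2) ^ 2 := by positivity
  simp only [hudef] at h1
  linarith

/-! ### The strong maximum principle -/

/-- **Parabolic strong maximum principle on whole-space slabs** (Nirenberg 1953).  On `[t₀, T] × ℝ³`: a classical
sub-solution `w` of `∂ₜw + Dw(b) − Δw ≤ 0` (jointly continuous, `C²` slices, classical time derivative `wt`) with drift
bounded by `A` and `w ≤ M`, which ATTAINS `M` at a point `(t⋆, x⋆)` with `t₀ < t⋆ ≤ T`, is identically `M` on
`[t₀, t⋆) × ℝ³`.  (Every point `(t, x)` with `t < t⋆` is joined to `(t⋆, x⋆)` by the ray of velocity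
`ξ = (x⋆ − x)/(t⋆ − t)`; if `w(t, x) < M`, `lt_of_gap_on_ball` gives `w(t⋆, x⋆) < M`.)
[cite: Lieberman1996, Ch. II Thm. 2.7] -/
theorem strongMaximumPrinciple {b : ℝ → EuclideanSpace ℝ (Fin 3) → EuclideanSpace ℝ (Fin 3)} {A M : ℝ}
    {w wt : ℝ → EuclideanSpace ℝ (Fin 3) → ℝ} {t₀ T : ℝ}
    (hbA : ∀ t ∈ Icc t₀ T, ∀ x, ‖b t x‖ ≤ A)
    (hw_c : ContinuousOn (uncurry w) (Icc t₀ T ×ˢ univ))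
    (hw2 : ∀ t ∈ Icc t₀ T, ContDiff ℝ 2 (w t))
    (hwt : ∀ x, ∀ t ∈ Icc t₀ T, HasDerivAt (fun τ => w τ x) (wt t x) t)
    (hlaw : ∀ t ∈ Icc t₀ T, ∀ x, wt t x + fderiv ℝ (w t) x (b t x) - (Δ (w t)) x ≤ 0)
    (hle : ∀ t ∈ Icc t₀ T, ∀ x, w t x ≤ M)
    {ts : ℝ} (hts : ts ∈ Ioc t₀ T) {xs : EuclideanSpace ℝ (Fin 3)} (hmax : w ts xs = M) :
    ∀ t ∈ Ico t₀ ts, ∀ x, w t x = M := by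
  intro t ht x
  by_contra hne
  have htI : t ∈ Icc t₀ T := ⟨ht.1, (ht.2.le.trans hts.2)⟩
  have hlt : w t x < M := lt_of_le_of_ne (hle t htI x) hne
  -- a gap on a small closed ball around `x` at time `t`
  set γ : ℝ := (M - w t x) / 2 with hγ
  have hγ0 : 0 < γ := by rw [hγ]; linarith
  obtain ⟨r, hr, hgap⟩ : ∃ r > 0, ∀ x', ‖x' - x‖ ≤ r → w t x' ≤ M - γ := by
    have hc : ContinuousAt (w t) x := (hw2 t htI).continuous.continuousAt
    have hev : ∀ᶠ x' in 𝓝 x, w t x' < w t x + γ := hc.eventually (gt_mem_nhds (by linarith))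
    rw [Metric.eventually_nhds_iff] at hev
    obtain ⟨ε, hε, h⟩ := hev
    refine ⟨ε / 2, by positivity, fun x' hx' => ?_⟩
    have h1 : dist x' x < ε := by rw [dist_eq_norm]; linarith
    have h2 := h h1
    rw [hγ]; linarith
  -- the ray from `(t, x)` to `(ts, xs)`
  have hst : 0 < ts - t := sub_pos.2 ht.2
  set ξ : EuclideanSpace ℝ (Fin 3) := (ts - t)⁻¹ • (xs - x) with hξ
  have h := lt_of_gap_on_ball hbA hw_c hw2 hwt hlaw hle ⟨ht.1, ht.2.trans_le hts.2⟩ hr hγ0 hgap ξ ts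
    ⟨ht.2, hts.2⟩
  have hpt : x + (ts - t) • ξ = xs := by
    rw [hξ, smul_smul, mul_inv_cancel₀ hst.ne', one_smul, add_sub_cancel]
  rw [hpt, hmax] at h
  exact lt_irrefl _ h

/-- The strong maximum principle up to the top time: under the hypotheses of `strongMaximumPrinciple`, `w ≡ M` on the
CLOSED range `[t₀, t⋆] × ℝ³` (the slice `t = t⋆` by continuity in time). [cite: Lieberman1996, Ch. II Thm. 2.7] -/
theorem eq_of_interior_max {b : ℝ → EuclideanSpace ℝ (Fin 3) → EuclideanSpace ℝ (Fin 3)} {A M : ℝ}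
    {w wt : ℝ → EuclideanSpace ℝ (Fin 3) → ℝ} {t₀ T : ℝ}
    (hbA : ∀ t ∈ Icc t₀ T, ∀ x, ‖b t x‖ ≤ A)
    (hw_c : ContinuousOn (uncurry w) (Icc t₀ T ×ˢ univ))
    (hw2 : ∀ t ∈ Icc t₀ T, ContDiff ℝ 2 (w t))
    (hwt : ∀ x, ∀ t ∈ Icc t₀ T, HasDerivAt (fun τ => w τ x) (wt t x) t)
    (hlaw : ∀ t ∈ Icc t₀ T, ∀ x, wt t x + fderiv ℝ (w t) x (b t x) - (Δ (w t)) x ≤ 0)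
    (hle : ∀ t ∈ Icc t₀ T, ∀ x, w t x ≤ M)
    {ts : ℝ} (hts : ts ∈ Ioc t₀ T) {xs : EuclideanSpace ℝ (Fin 3)} (hmax : w ts xs = M) :
    ∀ t ∈ Icc t₀ ts, ∀ x, w t x = M := by
  have hS := strongMaximumPrinciple hbA hw_c hw2 hwt hlaw hle hts hmax
  intro t ht x
  rcases lt_or_eq_of_le ht.2 with hlt | heq
  · exact hS t ⟨ht.1, hlt⟩ x
  · subst heq
    -- continuity in time at `t = ts`
    have hc : ContinuousAt (fun τ => w τ x) t := (hwt x t ⟨hts.1.le, hts.2⟩).continuousAt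
    haveI : (𝓝[Ico t₀ t] t).NeBot := by
      refine mem_closure_iff_nhdsWithin_neBot.1 ?_
      rw [closure_Ico hts.1.ne]
      exact right_mem_Icc.2 hts.1.le
    have h1 : Tendsto (fun τ => w τ x) (𝓝[Ico t₀ t] t) (𝓝 (w t x)) := hc.continuousWithinAt.tendsto
    have h2 : Tendsto (fun τ => w τ x) (𝓝[Ico t₀ t] t) (𝓝 M) := by
      refine tendsto_const_nhds.congr' ?_
      filter_upwards [self_mem_nhdsWithin] with τ hτ
      exact (hS τ hτ x).symm
    exact tendsto_nhds_unique h1 h2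

/-- **Dissipation bookkeeping at an attained maximum.**  If, in the setting of `strongMaximumPrinciple`, the
sub-solution inequality holds with a nonnegative DISSIPATION term, `∂ₜw + Dw(b) − Δw ≤ −D`, `D ≥ 0`, then `D ≡ 0` on
`(t₀, t⋆) × ℝ³`: there `w ≡ M`, so `∂ₜw = 0`, `Dw = 0`, `Δw = 0`. [folklore] -/
theorem dissipation_eq_zero_of_max {b : ℝ → EuclideanSpace ℝ (Fin 3) → EuclideanSpace ℝ (Fin 3)} {A M : ℝ}
    {w wt D : ℝ → EuclideanSpace ℝ (Fin 3) → ℝ} {t₀ T : ℝ}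
    (hbA : ∀ t ∈ Icc t₀ T, ∀ x, ‖b t x‖ ≤ A)
    (hw_c : ContinuousOn (uncurry w) (Icc t₀ T ×ˢ univ))
    (hw2 : ∀ t ∈ Icc t₀ T, ContDiff ℝ 2 (w t))
    (hwt : ∀ x, ∀ t ∈ Icc t₀ T, HasDerivAt (fun τ => w τ x) (wt t x) t)
    (hD0 : ∀ t ∈ Icc t₀ T, ∀ x, 0 ≤ D t x)
    (hlawD : ∀ t ∈ Icc t₀ T, ∀ x, wt t x + fderiv ℝ (w t) x (b t x) - (Δ (w t)) x ≤ -D t x)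
    (hle : ∀ t ∈ Icc t₀ T, ∀ x, w t x ≤ M)
    {ts : ℝ} (hts : ts ∈ Ioc t₀ T) {xs : EuclideanSpace ℝ (Fin 3)} (hmax : w ts xs = M) :
    ∀ t ∈ Ioo t₀ ts, ∀ x, D t x = 0 := by
  have hlaw : ∀ t ∈ Icc t₀ T, ∀ x, wt t x + fderiv ℝ (w t) x (b t x) - (Δ (w t)) x ≤ 0 :=
    fun t ht x => (hlawD t ht x).trans (neg_nonpos.2 (hD0 t ht x))
  have hS := strongMaximumPrinciple hbA hw_c hw2 hwt hlaw hle hts hmax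
  intro t ht x
  have htI : t ∈ Icc t₀ T := ⟨ht.1.le, ht.2.le.trans hts.2⟩
  -- the slice `w t` is the constant `M`
  have hslice : w t = fun _ => M := funext fun y => hS t ⟨ht.1.le, ht.2⟩ y
  have hD : fderiv ℝ (w t) x = 0 := by rw [hslice]; simp
  have hL : (Δ (w t)) x = 0 := by rw [hslice, laplacian_const]; simp
  -- the time derivative vanishes
  have hev : (fun τ => w τ x) =ᶠ[𝓝 t] fun _ => M := by
    filter_upwards [Ioo_mem_nhds ht.1 ht.2] with τ hτ
    exact hS τ ⟨hτ.1.le, hτ.2⟩ x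
  have h0 : HasDerivAt (fun τ => w τ x) 0 t := (hasDerivAt_const t M).congr_of_eventuallyEq hev
  have hwt0 : wt t x = 0 := (hwt x t htI).unique h0
  have h := hlawD t htI x
  rw [hwt0, hD, hL] at h
  simp only [zero_apply, add_zero, sub_zero] at h
  linarith [hD0 t htI x]

end Summit.NavierStokesRegularity.NavierStokesRegularity.Theorems.PoloidalWindowDoorPoloidalWindowRigidityStrongMaxPrinciple

end
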